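import Summits.QuantumFields.YangMills.Theorems.UV3AxialLaunderingFreeSlot
import Literature.MathematicalPhysics.QuantumFieldTheory.Balaban1983to89.B12SmallFieldDomain259
import HarnessLib

/-!
# R3 (cell `ym3-torus`, YM₃ on T³ — a ladder RUNG, NOT d = 4, NOT infinite volume, NOT a mass gap, NOT the Clay problem) —
# **FREE-SLOT GEOMETRY: a straight segment has `L + 1` distinct sites, so a density reading only the bonds with BOTH end points in a site set `B` is laundered
# by the straight transporter as soon as every segment has a site outside `B` — in particular ALWAYS when `|B| ≤ L` (small supports are invisible one level up)**

Width seat `ym3-torus-px8` g12 on crux `stmt-QuantumFields-19936` `UnitScaleTilt.HistoryTailL` (`--supports`, helper; THEOREMS ONLY, 0 `def`, 0 `sorry`).  Sequel of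
✓`UV3AxialLaunderingFreeSlot` (p755566).  Serves milestone (M3)∕(M4) of the N08 seat's hTop design (`N08-HJ-LOOPPART-DESIGN-g47.md`, `N08-HJ-M3-SPEC-g47.md` §2–§3): after a
guarded step with fired set `S`, the transported density is a function of the coarse bonds with BOTH end blocks in `Blk(S)` (pub-ymgap n08-w3 part 37
`…GuardHybridNearBlocks`: «near ⟺ both end blocks in `Blk(S)`»; for `S = {c}`, near `= {c}`); the NEXT blocking launders such a density exactly unless some next-level segment has
all its `L + 1` sites in `Blk(S)` — the «continuation» of the cluster.  THIS FILE types that geometry in lit `AveragingRT` letters and composes it with the free-slot theorem.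

CONTENTS.
* §1 lattice (standing range `j + 1 ≤ m + K`): `line_src`∕`line_dir`∕`line_tgt` (`(line C s).tgt = lineSite C (s+1)`), ★ `lineSite_inj_le` (the sites `lineSite C s`, `s ≤ L`, are pairwise
  distinct — lo∕hi halves via lit `lineSite_eq_lo∕hi` + `blockSite_inj`, the two halves lying in the distinct blocks `C₋ ≠ C₊`, lit `B12SmallFieldDomain259.src_ne_tgt`),
  `card_image_lineSite` (`= L + 1`).
* §2 ★ `exists_freeSlot_of_lineSite_notMem` — a site of the segment outside `B` yields a bond of the segment with an END POINT outside `B`; ★ `exists_lineSite_notMem_of_card_le`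
  (pigeonhole: `|B| ≤ L` ⇒ some site of every segment is outside `B`).
* §3 ★★★ `map_withDensity_axialAvg_eq_smul_of_endsIn` — if `f` reads only the bonds with both end points in `B` and every segment has a site outside `B`, then
  `((dU_j).withDensity f).map axialAvg = (∫⁻ f)•dU_{j+1}` (p755566 `…_of_readSet` at `R := {b | b₋ ∈ B ∧ b₊ ∈ B}`); ★★★ `map_withDensity_axialAvg_eq_smul_of_endsIn_of_card_le` — the
  same with the hypothesis `|B| ≤ L` only (single firing: `B = {c₋, c₊}`, `2 ≤ L`); set forms `map_restrict_axialAvg_eq_smul_of_endsIn(_of_card_le)`.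

HONEST SCOPE.  [folklore] lattice bookkeeping + p755566; nothing of hTop ∕ (M3) ∕ (M4) ∕ hJ ∕ `HistoryTailL` (19936) ∕ the rung ∕ d = 4 ∕ a mass gap ∕ Clay is proved here; the identification
«transported density reads only the near set» is the N08 seat's (part 37 ∕ (M4)), not this file's.  YM₃ on T³ is rung R3 of the ladder, not the Clay problem.

References: T. Bałaban, Commun. Math. Phys. **109** (1987) 249–301 [Balaban1987RG1] ((0.1) p. 251 lattice, (0.4) p. 253); T. Bałaban, Commun. Math. Phys. **95** (1984) 17–40
[Balaban1984PropagatorsI] ((1.7) p. 18, the straight contour); T. Bałaban, Commun. Math. Phys. **98** (1985) 17–51 [Balaban1985Averaging] ((10) p. 19).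
-/

set_option autoImplicit false

noncomputable section

open MeasureTheory
open scoped ENNReal

namespace Summit.QuantumFields.YangMills.Theorems.UV3AxialLaunderingFreeSlotGeometry

open Literature.MathematicalPhysics.QuantumFieldTheory.Balaban1983to89
open Literature.MathematicalPhysics.QuantumFieldTheory.Balaban1983to89.AveragingRT
open Summit.QuantumFields.YangMills.Theorems.UV3AxialLaunderingFreeSlot

/-! ## §1 Lattice: the `L + 1` sites of a straight segment are pairwise distinct -/
section Lattice

variable {P : Params} {j : ℕ}

/-- The `s`-th bond of the segment issues from its `s`-th site. [folklore] -/
theorem line_src (C : PBond P (j + 1)) (s : ℕ) : (line C s).src = lineSite C s := rfl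

/-- The bonds of the segment of `C` point in the direction of `C`. [folklore] -/
theorem line_dir (C : PBond P (j + 1)) (s : ℕ) : (line C s).dir = C.dir := rfl

/-- The `s`-th bond of the segment ends at its `(s+1)`-th site. [cite: Balaban1984PropagatorsI, (1.7) p.18] -/
theorem line_tgt (C : PBond P (j + 1)) (s : ℕ) : (line C s).tgt = lineSite C (s + 1) := by
  rw [lineSite_succ]; rfl

/-- ★ **THE SITES `lineSite C s`, `s ≤ L`, OF A STRAIGHT SEGMENT ARE PAIRWISE DISTINCT** (standing range): the first half lies in `B(C₋)`, the second (including the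
end centre `s = L`) in `B(C₊)`, `C₋ ≠ C₊`, and inside a block the offset records `s`. [cite: Balaban1984PropagatorsI, (1.7) p.18] -/
theorem lineSite_inj_le (hj : j + 1 ≤ P.m + P.K) (C : PBond P (j + 1)) {s s' : ℕ} (hs : s ≤ P.L) (hs' : s' ≤ P.L)
    (h : lineSite C s = lineSite C s') : s = s' := by
  have hL := P.hL.2
  obtain ⟨k, hk⟩ := P.hL.1
  have hne : C.src ≠ C.tgt := B12SmallFieldDomain259.src_ne_tgt C
  by_cases hlo : s ≤ (P.L - 1) / 2 <;> by_cases hlo' : s' ≤ (P.L - 1) / 2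
  · rw [lineSite_eq_lo hj C hlo, lineSite_eq_lo hj C hlo'] at h
    have := congrArg Fin.val (congrFun (blockSite_inj hj h).2 C.dir)
    simp only [offLo, if_true, Fin.val_mk] at this
    omega
  · rw [lineSite_eq_lo hj C hlo, lineSite_eq_hi hj C (lt_of_not_ge hlo') hs'] at h
    exact absurd (blockSite_inj hj h).1 hne
  · rw [lineSite_eq_hi hj C (lt_of_not_ge hlo) hs, lineSite_eq_lo hj C hlo'] at h
    exact absurd (blockSite_inj hj h).1.symm hne
  · rw [lineSite_eq_hi hj C (lt_of_not_ge hlo) hs, lineSite_eq_hi hj C (lt_of_not_ge hlo') hs'] at h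
    have := congrArg Fin.val (congrFun (blockSite_inj hj h).2 C.dir)
    simp only [offHi, if_true, Fin.val_mk] at this
    omega

/-- A straight segment has exactly `L + 1` sites. [cite: Balaban1984PropagatorsI, (1.7) p.18] -/
theorem card_image_lineSite (hj : j + 1 ≤ P.m + P.K) (C : PBond P (j + 1)) :
    ((Finset.range (P.L + 1)).image (lineSite C)).card = P.L + 1 := by
  rw [Finset.card_image_of_injOn, Finset.card_range]
  intro s hs s' hs' h
  exact lineSite_inj_le hj C (by simpa [Nat.lt_succ_iff] using hs) (by simpa [Nat.lt_succ_iff] using hs') h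

end Lattice

/-! ## §2 A missing site yields a bond with a free end; small site sets miss every segment -/
section Slots

variable {P : Params} {j : ℕ}

/-- ★ **A SITE OF THE SEGMENT OUTSIDE `B` YIELDS A BOND OF THE SEGMENT WITH AN END POINT OUTSIDE `B`** (`s < L`: the bond issuing from it; `s = L`: the last bond,
ending at it). [folklore] -/
theorem exists_freeSlot_of_lineSite_notMem (C : PBond P (j + 1)) (B : Finset (Site P j)) {s : ℕ} (hs : s ≤ P.L)
    (hB : lineSite C s ∉ B) : ∃ t : ℕ, t < P.L ∧ ((line C t).src ∉ B ∨ (line C t).tgt ∉ B) := by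
  have hL := P.hL.2
  rcases Nat.lt_or_ge s P.L with hlt | hge
  · exact ⟨s, hlt, Or.inl hB⟩
  · have hsL : s = P.L := le_antisymm hs hge
    refine ⟨P.L - 1, by omega, Or.inr ?_⟩
    rw [line_tgt, show P.L - 1 + 1 = s by omega]
    exact hB

/-- ★ **PIGEONHOLE**: if `|B| ≤ L`, every straight segment has a site outside `B` (its `L + 1` sites are distinct). [folklore] -/
theorem exists_lineSite_notMem_of_card_le (hj : j + 1 ≤ P.m + P.K) (B : Finset (Site P j)) (hcard : B.card ≤ P.L) (C : PBond P (j + 1)) :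
    ∃ s : ℕ, s ≤ P.L ∧ lineSite C s ∉ B := by
  by_contra hcon
  push Not at hcon
  have hsub : (Finset.range (P.L + 1)).image (lineSite C) ⊆ B := by
    intro x hx
    obtain ⟨s, hs, rfl⟩ := Finset.mem_image.1 hx
    exact hcon s (by simpa [Nat.lt_succ_iff] using hs)
  have := Finset.card_le_card hsub
  rw [card_image_lineSite hj C] at this
  omega

/-- Combining the two: `|B| ≤ L` ⇒ every segment has a bond with an end point outside `B`. [folklore] -/
theorem exists_freeSlot_of_card_le (hj : j + 1 ≤ P.m + P.K) (B : Finset (Site P j)) (hcard : B.card ≤ P.L) (C : PBond P (j + 1)) :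
    ∃ t : ℕ, t < P.L ∧ ((line C t).src ∉ B ∨ (line C t).tgt ∉ B) := by
  obtain ⟨s, hs, hB⟩ := exists_lineSite_notMem_of_card_le hj B hcard C
  exact exists_freeSlot_of_lineSite_notMem C B hs hB

end Slots

/-! ## §3 Laundering of densities that read only bonds with both end points in `B` -/
section Laundering

variable {P : Params} {j : ℕ} {G : Type*} [GaugeGroup G] [MeasurableSpace G] [HaarData G] [MeasurableMul₂ G]

/-- ★★★ **NEAR-SET LAUNDERING**: if `f` reads only the bonds with BOTH end points in the site set `B` (`U = U′` on those bonds ⇒ `f U = f U′`) and every straight segment of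
the next blocking has a site outside `B`, then `((dU_j).withDensity f).map axialAvg = (∫⁻ f dU_j) • dU_{j+1}` — the shape is invisible one level up (p755566 `…_of_readSet` with the
read set `{b | b₋ ∈ B ∧ b₊ ∈ B}` and, per segment, the slot of §2). [cite: Balaban1987RG1, (0.4) p.253; Balaban1985Averaging, (10) p.19] -/
theorem map_withDensity_axialAvg_eq_smul_of_endsIn (hj : j + 1 ≤ P.m + P.K) (B : Finset (Site P j))
    {f : GaugeField P j G → ℝ≥0∞} (hf : Measurable f)
    (hB : ∀ U U' : GaugeField P j G, (∀ b : PBond P j, b.src ∈ B → b.tgt ∈ B → U b = U' b) → f U = f U')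
    (hmiss : ∀ C : PBond P (j + 1), ∃ s : ℕ, s ≤ P.L ∧ lineSite C s ∉ B) :
    ((fieldMeasure P j G).withDensity f).map (axialAvg : GaugeField P j G → GaugeField P (j + 1) G) =
      (∫⁻ U, f U ∂(fieldMeasure P j G)) • fieldMeasure P (j + 1) G := by
  have hslot : ∀ C : PBond P (j + 1), ∃ t : ℕ, t < P.L ∧ ((line C t).src ∉ B ∨ (line C t).tgt ∉ B) := fun C => by
    obtain ⟨s, hs, hsB⟩ := hmiss C
    exact exists_freeSlot_of_lineSite_notMem C B hs hsB
  choose t ht hfree using hslot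
  refine map_withDensity_axialAvg_eq_smul_of_readSet hj t ht hf {b : PBond P j | b.src ∈ B ∧ b.tgt ∈ B}
    (fun U U' hUU' => hB U U' fun b hb1 hb2 => hUU' b ⟨hb1, hb2⟩) fun C hC => ?_
  rcases hfree C with h | h
  · exact h hC.1
  · exact h hC.2

/-- ★★★ **SMALL SUPPORTS ARE ALWAYS INVISIBLE ONE LEVEL UP**: if `f` reads only the bonds with both end points in a site set `B` with `|B| ≤ L`, then
`((dU_j).withDensity f).map axialAvg = (∫⁻ f dU_j) • dU_{j+1}` (§2 pigeonhole + `…_of_endsIn`).  E.g. a single fired bond `c`: the transported shape reads only `c`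
(`B = {c₋, c₊}`, `2 ≤ L`). [cite: Balaban1987RG1, (0.4) p.253; Balaban1985Averaging, (10) p.19] -/
theorem map_withDensity_axialAvg_eq_smul_of_endsIn_of_card_le (hj : j + 1 ≤ P.m + P.K) (B : Finset (Site P j)) (hcard : B.card ≤ P.L)
    {f : GaugeField P j G → ℝ≥0∞} (hf : Measurable f)
    (hB : ∀ U U' : GaugeField P j G, (∀ b : PBond P j, b.src ∈ B → b.tgt ∈ B → U b = U' b) → f U = f U') :
    ((fieldMeasure P j G).withDensity f).map (axialAvg : GaugeField P j G → GaugeField P (j + 1) G) =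
      (∫⁻ U, f U ∂(fieldMeasure P j G)) • fieldMeasure P (j + 1) G :=
  map_withDensity_axialAvg_eq_smul_of_endsIn hj B hf hB (exists_lineSite_notMem_of_card_le hj B hcard)

/-- ★ **SET FORM**: an event determined by the bonds with both end points in `B`, every segment missing `B` somewhere ⇒ `(dU_j↾E)∘Ū_ax⁻¹ = dU_j(E)•dU_{j+1}`. [folklore] -/
theorem map_restrict_axialAvg_eq_smul_of_endsIn (hj : j + 1 ≤ P.m + P.K) (B : Finset (Site P j))
    {E : Set (GaugeField P j G)} (hE : MeasurableSet E)
    (hB : ∀ U U' : GaugeField P j G, (∀ b : PBond P j, b.src ∈ B → b.tgt ∈ B → U b = U' b) → (U ∈ E ↔ U' ∈ E))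
    (hmiss : ∀ C : PBond P (j + 1), ∃ s : ℕ, s ≤ P.L ∧ lineSite C s ∉ B) :
    ((fieldMeasure P j G).restrict E).map (axialAvg : GaugeField P j G → GaugeField P (j + 1) G) =
      (fieldMeasure P j G E) • fieldMeasure P (j + 1) G := by
  classical
  have hind : ∀ U U' : GaugeField P j G, (∀ b : PBond P j, b.src ∈ B → b.tgt ∈ B → U b = U' b) →
      E.indicator (1 : GaugeField P j G → ℝ≥0∞) U = E.indicator (1 : GaugeField P j G → ℝ≥0∞) U' := by
    intro U U' h
    by_cases hU : U ∈ E
    · have hU' : U' ∈ E := (hB U U' h).1 hU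
      simp only [Set.indicator, hU, hU', if_true, Pi.one_apply]
    · have hU' : U' ∉ E := fun h' => hU ((hB U U' h).2 h')
      simp only [Set.indicator, hU, hU', if_false]
  rw [← withDensity_indicator_one hE, map_withDensity_axialAvg_eq_smul_of_endsIn hj B (measurable_one.indicator hE) hind hmiss,
    lintegral_indicator_one hE]

/-- ★ **SET FORM, SMALL SUPPORT**: `|B| ≤ L` ⇒ `(dU_j↾E)∘Ū_ax⁻¹ = dU_j(E)•dU_{j+1}` for every event determined by the bonds with both end points in `B`. [folklore] -/
theorem map_restrict_axialAvg_eq_smul_of_endsIn_of_card_le (hj : j + 1 ≤ P.m + P.K) (B : Finset (Site P j)) (hcard : B.card ≤ P.L)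
    {E : Set (GaugeField P j G)} (hE : MeasurableSet E)
    (hB : ∀ U U' : GaugeField P j G, (∀ b : PBond P j, b.src ∈ B → b.tgt ∈ B → U b = U' b) → (U ∈ E ↔ U' ∈ E)) :
    ((fieldMeasure P j G).restrict E).map (axialAvg : GaugeField P j G → GaugeField P (j + 1) G) =
      (fieldMeasure P j G E) • fieldMeasure P (j + 1) G :=
  map_restrict_axialAvg_eq_smul_of_endsIn hj B hE hB (exists_lineSite_notMem_of_card_le hj B hcard)

end Laundering

end Summit.QuantumFields.YangMills.Theorems.UV3AxialLaunderingFreeSlotGeometry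

end
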